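import Summits.Schanuel.Schanuel.Theorems.ZilberEacParamCurveLogRoot
import HarnessLib

/-!
# Polynomially parametrised base curves, XVI: logarithmically corrected stage roots on the ray,
# packaged with the growth of the escape coordinate

HONEST FRAMING.  Cell `pub-schanuel` (Zilber's Exponential-Algebraic Closedness, case ladder;
host summit Schanuel), seat 2, gen 19.  Input of the directional engine with a logarithmic balance
(`ZilberEacParamCurveEscapeLog`, unbalanced edges over a polynomial curve): stage sizes
`Λ_j, Λ'_j → ∞`, exact roots `z₀(j)` with logarithms `L(j)` of `e^{R(z₀)} = e^{c₀} e^{μ L}` ON a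
root direction `ω` of `R` (file XV), and on the unit disc around them `Re G ≤ -Λ'_j`,
`‖G‖ ≤ A Λ'_j` when `Re(lc(G) ω^{deg G}) < 0` (file II).  Instances of Mantova–Masser's OPEN
question (PLMS 2024 §1 p. 5) are the goal; NOT Schanuel's conjecture (neither used nor implied;
EAC ⇏ SC); `EC(3,2)` stays OPEN.
-/

noncomputable section

open Filter Topology Metric Set Complex Polynomial
open Literature.ModelTheory.Zilber

set_option linter.dupNamespace false

namespace Summit.Schanuel.Schanuel.Theorems

/-- `α + β log((k+1)ν) ≤ k + 1` eventually (`α, β ≥ 0`, `ν > 0`). -/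
theorem eventually_affine_log_le {α β ν : ℝ} (hβ : 0 ≤ β) (hν : 0 < ν) :
    ∀ᶠ k : ℕ in atTop, α + β * Real.log (((k : ℝ) + 1) * ν) ≤ (k : ℝ) + 1 := by
  have h := eventually_alRoot_log_hyp (Real.pi * α / 16) (Real.pi * β / 16) hν
  filter_upwards [h] with k hk
  obtain ⟨hk1, hk2⟩ := hk
  have hπ := Real.pi_pos
  have hlog : 0 ≤ Real.log (((k : ℝ) + 1) * ν) := Real.log_nonneg hk1
  rw [abs_of_nonneg (by positivity)] at hk2
  nlinarith

/-- **Logarithmically corrected stage roots on the ray.**  See the module docstring. (new) -/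
theorem exists_ray_roots_log (R G : Polynomial ℂ) (hd : 2 ≤ R.natDegree) (hm : 1 ≤ G.natDegree)
    (ω : ℂ) (s : ℤ) (hs : s = 1 ∨ s = -1)
    (hω : R.leadingCoeff * ω ^ R.natDegree = 2 * Real.pi * I * s)
    (hdir : (G.leadingCoeff * ω ^ G.natDegree).re < 0) (μ : ℝ) (c₀ : ℂ) :
    ∃ (z₀ Lg : ℕ → ℂ) (Λ Λ' : ℕ → ℝ) (A : ℝ), Tendsto Λ atTop atTop ∧ Tendsto Λ' atTop atTop ∧
      (∀ j, 0 ≤ Λ j) ∧ (∀ j, 0 ≤ Λ' j) ∧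
      (∀ (N : ℕ) (c : ℝ), 0 < c →
        Tendsto (fun j => (2 + 3 * Λ j) ^ N * Real.exp (-(c * Λ' j))) atTop (𝓝 0)) ∧
      ∀ j, exp (Lg j) = z₀ j ∧ exp (R.eval (z₀ j)) = exp c₀ * exp ((μ : ℂ) * Lg j) ∧
        (R.eval (z₀ j)).re = c₀.re + μ * Real.log ‖z₀ j‖ ∧ 1 ≤ ‖z₀ j‖ ∧
        2 ≤ ‖R.leadingCoeff‖ * ‖z₀ j‖ ∧ Λ j / 3 ≤ ‖z₀ j‖ ∧ ‖z₀ j‖ ≤ 3 * Λ j ∧ 16 ≤ ‖z₀ j‖ ∧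
        (∀ z : ℂ, ‖z - z₀ j‖ ≤ 1 → (G.eval z).re ≤ -Λ' j ∧ ‖G.eval z‖ ≤ A * Λ' j) := by
  set d : ℕ := R.natDegree with hd_def
  set a : ℂ := R.leadingCoeff with ha_def
  set ℓ : Polynomial ℂ := R.eraseLead with hℓ_def
  obtain ⟨m, hm_def⟩ : ∃ m : ℕ, m = G.natDegree := ⟨_, rfl⟩
  obtain ⟨b, hb_def⟩ : ∃ b : ℂ, b = G.leadingCoeff := ⟨_, rfl⟩
  rw [← hm_def, ← hb_def] at hdir
  rw [← hm_def] at hm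
  have hd1 : 1 ≤ d := by omega
  have hR0 : R ≠ 0 := by
    rintro rfl
    rw [hd_def, Polynomial.natDegree_zero] at hd
    omega
  have ha0 : a ≠ 0 := Polynomial.leadingCoeff_ne_zero.2 hR0
  have hapos : 0 < ‖a‖ := norm_pos_iff.2 ha0
  have hrhs : (2 * Real.pi * I * s : ℂ) ≠ 0 := by
    have hsC : (s : ℂ) ≠ 0 := by rcases hs with rfl | rfl <;> simp
    have hπ : (Real.pi : ℂ) ≠ 0 := Complex.ofReal_ne_zero.mpr Real.pi_pos.ne'
    simp [hsC, hπ, Complex.I_ne_zero]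
  have hω0 : ω ≠ 0 := by
    rintro rfl
    rw [zero_pow (by omega), mul_zero] at hω
    exact hrhs hω.symm
  have hωpos : 0 < ‖ω‖ := norm_pos_iff.mpr hω0
  have hπ := Real.pi_pos
  -- constants (the `k`-independent parts)
  set C₀ : ℝ := coeffNormSum ℓ * (3 * ‖ω‖ + 1) ^ (d - 1) + ‖c₀‖ with hC₀
  have hC₀0 : 0 ≤ C₀ := by have := coeffNormSum_nonneg ℓ; positivity
  set A₀ : ℝ := -(b * ω ^ m).re with hA₀_def
  have hA₀ : 0 < A₀ := by rw [hA₀_def]; linarith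
  set K₃ : ℝ := coeffNormSum G * (3 * ‖ω‖ + 1) ^ m with hK₃
  have hK₃0 : 0 ≤ K₃ := by have := coeffNormSum_nonneg G; positivity
  set Kc : ℝ := (m * ‖b‖ + coeffNormSum G.eraseLead) * (3 * ‖ω‖ + 1) ^ (m - 1) with hKc
  have hKc0 : 0 ≤ Kc := by have := coeffNormSum_nonneg G.eraseLead; positivity
  -- `K₁(k) = (C₀ + |μ|(log((k+1)‖ω‖) + 5))/π`, `K₂(k) = 2 m K₁(k) ‖b‖‖ω‖^m + Kc`
  -- eventual conditions
  have hk1 : Tendsto (fun k : ℕ => (k : ℝ) + 1) atTop atTop := tendsto_natCast_add_atTop 1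
  have hev₁ := eventually_alRoot_log_hyp C₀ μ hωpos
  have hev₂ : ∀ᶠ k : ℕ in atTop, 48 ≤ ((k : ℝ) + 1) * ‖ω‖ :=
    (hk1.atTop_mul_const hωpos).eventually_ge_atTop 48
  have hev₃ : ∀ᶠ k : ℕ in atTop, 6 ≤ ‖a‖ * (((k : ℝ) + 1) * ‖ω‖) :=
    ((hk1.atTop_mul_const hωpos).const_mul_atTop hapos).eventually_ge_atTop 6
  -- (i) `m K₁(k) ≤ k + 1`
  have hev₄ : ∀ᶠ k : ℕ in atTop, (m : ℝ) * ((C₀ + |μ| * 5) / Real.pi) +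
      (m : ℝ) * (|μ| / Real.pi) * Real.log (((k : ℝ) + 1) * ‖ω‖) ≤ (k : ℝ) + 1 :=
    eventually_affine_log_le (by positivity) hωpos
  -- (ii) `2 K₂(k) ≤ A₀ (k+1)`
  have hev₅ : ∀ᶠ k : ℕ in atTop,
      (2 * (2 * m * ((C₀ + |μ| * 5) / Real.pi) * ‖b‖ * ‖ω‖ ^ m + Kc)) / A₀ +
        (2 * (2 * m * (|μ| / Real.pi) * ‖b‖ * ‖ω‖ ^ m)) / A₀ * Real.log (((k : ℝ) + 1) * ‖ω‖) ≤
        (k : ℝ) + 1 :=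
    eventually_affine_log_le (by positivity) hωpos
  obtain ⟨K₀, hK₀⟩ := eventually_atTop.1 (hev₁.and (hev₂.and (hev₃.and (hev₄.and hev₅))))
  -- the roots at stage `j + K₀`
  have hroot : ∀ j : ℕ, ∃ z₀ Lg : ℂ, exp Lg = z₀ ∧ exp (R.eval z₀) = exp c₀ * exp ((μ : ℂ) * Lg) ∧
      (R.eval z₀).re = c₀.re + μ * Real.log ‖z₀‖ ∧
      1 ≤ ‖z₀‖ ∧ 2 ≤ ‖a‖ * ‖z₀‖ ∧ (((j + K₀ : ℕ) : ℝ) + 1) * ‖ω‖ / 3 ≤ ‖z₀‖ ∧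
      ‖z₀‖ ≤ 3 * ((((j + K₀ : ℕ) : ℝ) + 1) * ‖ω‖) ∧ 16 ≤ ‖z₀‖ ∧
      (∀ z : ℂ, ‖z - z₀‖ ≤ 1 → (G.eval z).re ≤ -(A₀ / 2 * (((j + K₀ : ℕ) : ℝ) + 1) ^ m) ∧
        ‖G.eval z‖ ≤ K₃ * (((j + K₀ : ℕ) : ℝ) + 1) ^ m) := by
    intro j
    obtain ⟨⟨h1a, h1b⟩, h2, h3, h4, h5⟩ := hK₀ (j + K₀) (Nat.le_add_left _ _)
    have hkk0 : (0 : ℝ) ≤ ((j + K₀ : ℕ) : ℝ) := Nat.cast_nonneg _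
    have hkkpos : (0 : ℝ) < ((j + K₀ : ℕ) : ℝ) + 1 := by linarith
    have hlog0 : 0 ≤ Real.log ((((j + K₀ : ℕ) : ℝ) + 1) * ‖ω‖) := Real.log_nonneg h1a
    obtain ⟨ζ, L, hζ, hζK, hLz, hz₀⟩ := exists_alRoot_log_dir R hd ω s hs hω μ c₀ (j + K₀) h1a
      (by rw [← hd_def, ← hℓ_def, ← hC₀]; exact h1b)
    rw [← hd_def, ← hℓ_def, ← hC₀] at hζK
    -- `K₁(k) = (C₀ + |μ|(log + 5))/π`
    have hζK' : ‖ζ‖ ≤ ((C₀ + |μ| * (Real.log ((((j + K₀ : ℕ) : ℝ) + 1) * ‖ω‖) + 5)) / Real.pi) /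
        (((j + K₀ : ℕ) : ℝ) + 1) := by
      rw [div_div]; exact hζK
    have hζm : (G.natDegree : ℝ) * ‖ζ‖ ≤ 1 := by
      rw [← hm_def]
      have hK₁le : (m : ℝ) * ((C₀ + |μ| * (Real.log ((((j + K₀ : ℕ) : ℝ) + 1) * ‖ω‖) + 5)) /
          Real.pi) ≤ ((j + K₀ : ℕ) : ℝ) + 1 := by
        have e : (m : ℝ) * ((C₀ + |μ| * (Real.log ((((j + K₀ : ℕ) : ℝ) + 1) * ‖ω‖) + 5)) /
            Real.pi) = (m : ℝ) * ((C₀ + |μ| * 5) / Real.pi) +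
            (m : ℝ) * (|μ| / Real.pi) * Real.log ((((j + K₀ : ℕ) : ℝ) + 1) * ‖ω‖) := by
          field_simp; ring
        rw [e]; exact h4
      calc (m : ℝ) * ‖ζ‖ ≤ (m : ℝ) * (((C₀ + |μ| * (Real.log ((((j + K₀ : ℕ) : ℝ) + 1) * ‖ω‖) +
            5)) / Real.pi) / (((j + K₀ : ℕ) : ℝ) + 1)) :=
            mul_le_mul_of_nonneg_left hζK' (Nat.cast_nonneg m)
        _ = (m : ℝ) * ((C₀ + |μ| * (Real.log ((((j + K₀ : ℕ) : ℝ) + 1) * ‖ω‖) + 5)) /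
            Real.pi) / (((j + K₀ : ℕ) : ℝ) + 1) := by ring
        _ ≤ 1 := by rw [div_le_one hkkpos]; exact hK₁le
    obtain ⟨hup, hlow⟩ := norm_ray_point_bounds ω hd1 (j + K₀) hζ
    have hReL : L.re = Real.log ‖(((j + K₀ : ℕ) : ℂ) + 1) * ω * exp (ζ / d)‖ :=
      re_eq_log_norm_of_exp_eq hLz
    refine ⟨(((j + K₀ : ℕ) : ℂ) + 1) * ω * exp (ζ / d), L, hLz, ?_, ?_, ?_, ?_, ?_, ?_, ?_,
      fun z hz => ⟨?_, ?_⟩⟩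
    · rw [hz₀, Complex.exp_add, Complex.exp_add, Complex.exp_int_mul_two_pi_mul_I, one_mul]
    · rw [hz₀, Complex.add_re, Complex.add_re, gce_re_intCast_mul_two_pi_I, zero_add,
        Complex.re_ofReal_mul, hReL]
    · push_cast at hlow h2 ⊢; linarith
    · push_cast at hlow h3 ⊢
      have := mul_le_mul_of_nonneg_left hlow hapos.le
      linarith
    · push_cast at hlow ⊢; linarith
    · push_cast at hup ⊢; linarith
    · push_cast at hlow h2 ⊢; linarith
    · have hmain := re_eval_near_ray_le G (hm_def ▸ hm) ω hd1
        (K₁ := (C₀ + |μ| * (Real.log ((((j + K₀ : ℕ) : ℝ) + 1) * ‖ω‖) + 5)) / Real.pi) (j + K₀)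
        hζ hζK' hζm (by push_cast at hz ⊢; exact hz)
      rw [← hm_def, ← hb_def] at hmain
      have hre : (b * ω ^ m).re = -A₀ := by rw [hA₀_def]; ring
      rw [hre] at hmain
      set kk : ℝ := ((j + K₀ : ℕ) : ℝ) + 1 with hkk
      set lg : ℝ := Real.log (kk * ‖ω‖) with hlg
      have hK₂le' : 2 * (2 * m * ((C₀ + |μ| * (lg + 5)) / Real.pi) * ‖b‖ * ‖ω‖ ^ m + Kc) ≤
          A₀ * kk := by
        have e : 2 * (2 * m * ((C₀ + |μ| * (lg + 5)) / Real.pi) * ‖b‖ * ‖ω‖ ^ m + Kc) =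
            A₀ * ((2 * (2 * m * ((C₀ + |μ| * 5) / Real.pi) * ‖b‖ * ‖ω‖ ^ m + Kc)) / A₀ +
              (2 * (2 * m * (|μ| / Real.pi) * ‖b‖ * ‖ω‖ ^ m)) / A₀ * lg) := by
          field_simp; ring
        rw [e]; exact mul_le_mul_of_nonneg_left h5 hA₀.le
      have hkkm : kk ^ m = kk * kk ^ (m - 1) := by
        rw [← pow_succ', Nat.sub_add_cancel hm]
      have hpow0 : (0 : ℝ) ≤ kk ^ (m - 1) := by positivity
      have h5' : 2 * m * ((C₀ + |μ| * (lg + 5)) / Real.pi) * ‖b‖ * ‖ω‖ ^ m + Kc ≤ A₀ / 2 * kk := by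
        linarith
      have hK₂le : (2 * m * ((C₀ + |μ| * (lg + 5)) / Real.pi) * ‖b‖ * ‖ω‖ ^ m + Kc) * kk ^ (m - 1) ≤
          (A₀ / 2 * kk) * kk ^ (m - 1) := mul_le_mul_of_nonneg_right h5' hpow0
      have e : (A₀ / 2 * kk) * kk ^ (m - 1) = A₀ / 2 * kk ^ m := by rw [hkkm]; ring
      rw [hKc] at hK₂le
      linarith
    · have := norm_eval_near_ray_le G ω hd1 (j + K₀) hζ (by push_cast at hz ⊢; exact hz)
      rw [← hm_def, ← hK₃] at this
      exact this
  choose z₀ Lg hLz hz₀e hz₀re hz₀1 hz₀2 hz₀low hz₀up hz₀16 hz₀G using hroot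
  -- the sizes
  set kk : ℕ → ℝ := fun j => ((j + K₀ : ℕ) : ℝ) + 1 with hkk_def
  have hkk : Tendsto kk atTop atTop := hk1.comp (tendsto_add_atTop_nat K₀)
  have hkk1 : ∀ j, 1 ≤ kk j := fun j => by
    have : (0 : ℝ) ≤ ((j + K₀ : ℕ) : ℝ) := Nat.cast_nonneg _
    simp only [hkk_def]; linarith
  refine ⟨z₀, Lg, fun j => kk j * ‖ω‖, fun j => A₀ / 2 * kk j ^ m, K₃ / (A₀ / 2),
    hkk.atTop_mul_const hωpos,
    ((tendsto_pow_atTop (by omega : m ≠ 0)).comp hkk).const_mul_atTop (half_pos hA₀),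
    fun j => by have := hkk1 j; positivity, fun j => by have := hkk1 j; positivity,
    fun N c hc => ?_,
    fun j => ⟨hLz j, hz₀e j, hz₀re j, hz₀1 j, hz₀2 j, hz₀low j, hz₀up j, hz₀16 j,
      fun z hz => ⟨(hz₀G j z hz).1, ?_⟩⟩⟩
  · have hc' : 0 < c * A₀ / 2 := by positivity
    have h0 := (tendsto_pow_mul_exp_neg_mul hc' N).comp hkk
    have h1 : Tendsto (fun j : ℕ => (2 + 3 * ‖ω‖) ^ N *
        (kk j ^ N * Real.exp (-(c * A₀ / 2 * kk j)))) atTop (𝓝 ((2 + 3 * ‖ω‖) ^ N * 0)) :=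
      h0.const_mul _
    rw [mul_zero] at h1
    refine squeeze_zero (fun j => by positivity) (fun j => ?_) h1
    have hbase : 2 + 3 * (kk j * ‖ω‖) ≤ (2 + 3 * ‖ω‖) * kk j := by
      nlinarith [norm_nonneg ω, hkk1 j]
    have hexp : Real.exp (-(c * (A₀ / 2 * kk j ^ m))) ≤ Real.exp (-(c * A₀ / 2 * kk j)) := by
      refine Real.exp_le_exp.2 (neg_le_neg ?_)
      have hp : kk j ≤ kk j ^ m := by
        calc kk j = kk j ^ 1 := (pow_one _).symm
          _ ≤ kk j ^ m := pow_le_pow_right₀ (hkk1 j) hm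
      nlinarith [hc, hA₀]
    calc (2 + 3 * (kk j * ‖ω‖)) ^ N * Real.exp (-(c * (A₀ / 2 * kk j ^ m)))
        ≤ ((2 + 3 * ‖ω‖) * kk j) ^ N * Real.exp (-(c * A₀ / 2 * kk j)) :=
          mul_le_mul (pow_le_pow_left₀ (by positivity) hbase N) hexp (Real.exp_nonneg _)
            (by positivity)
      _ = (2 + 3 * ‖ω‖) ^ N * (kk j ^ N * Real.exp (-(c * A₀ / 2 * kk j))) := by
          rw [mul_pow]; ring
  · refine (hz₀G j z hz).2.trans (le_of_eq ?_)
    simp only [hkk_def]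
    field_simp

end Summit.Schanuel.Schanuel.Theorems
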